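/-
Copyright (c) 2026 the pub-hodgecm-mathlib formalisation cell (harness21).  Prover seat hodgecm-mathlib-LH4-p16 (g4), req620 Track A «(D-RAM) FOUR-FRAME» squad
((β₂) road (R-36) «PURE-CELL LEDGER», lane C = type RamM: «THE CORNER RAY BAND OF LANE C IS PAID» — ‹HC_RAY_C♮›, the binder `hR` of ★ C6, from the two wide-strip
top-line workers), helper lane on h413 = stmt-HodgeConjecture-24833 (count-neutral).  2026-09-05.
-/
import Summits.HodgeConjecture.HodgeConjecture.Theorems.F0P3cDyRamBeta2ConesOffRowCUpperRayWorkerWide    -- (this seat) W7: `cellDiff_topLine_rayGen_eq_zero_ramM_wide` (generic branch on the wide strip `m < 4b + 2(d % 2)`)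
import Summits.HodgeConjecture.HodgeConjecture.Theorems.F0P3cDyRamBeta2ConesOffRowCUpperRayDiagWide      -- (this seat) W8: `cellDiff_topLine_rayDiag_eq_zero_ramM_wide` (diagonal branch on the wide strip)
import HarnessLib

/-!
# Crux `H413`, line LH4 «(D-RAM) FOUR-FRAME» — the (β₂) road (R-36), (OFF_C) residue, lane C (type RamM): «THE CORNER RAY BAND OF LANE C IS PAID» —
# `offRowCC_ray_holds (N) (hN : ∀ d t, 2·m_c d ≤ N d t) : ‹HC_RAY_C♮›` (= the binder `hR` of ★ C6 `…OffRowCCornerExactLevel.offRowCC_of_exactLevel_bands`, BYTE FOR BYTE)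

Cell `hodgecm-mathlib` (D-0151), FLOOR 0, crux item H413 = `stmt-HodgeConjecture-24833`, route of record `HCCMUnconditional`; squads F0∕P3c∕LH4 ∕ LH7; lane
`--supports stmt-HodgeConjecture-24833 --as helper` (count-neutral; pays NO tier-0 row).  THEOREMS ONLY (no `def`, no instance, no notation, no `sorry`, default heartbeats);
★-only imports; states NO law; (β₂) stays a HYPOTHESIS.

THE CORNER (★ C6; LH7-p10 (g3) HANDOFF «d odd, m_E = 2b»).  ‹HC_RAY_C♮› (HOME `F0/P3c/LH7/LH7-p10/g3/HC_RAY_Cnat.letter.v1…`, sha16 379203433b20d61f) = ‹OFF_C.letter.v2› (a2c0234d)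
BYTE FOR BYTE, then the corner cell tail `1 ≤ b → b ≤ j → d % 2 = 1 → m = 4 * b → jl = 2 * j + dρ + 2 * b → (j + 1 = b + s0 ∨ (b + s0 ≤ j ∧ (j - b - s0) % 2 = 0)) →
mstarOfRecord d ≤ b → IsOrd ρ α (jE ϖ ^ j) lam →` and the exact-level RAY literals' difference `= 0` (the same literals as ‹HU_RAY_C♮›).  THE CORNER CENSUS (this seat): the
corner is the top line `jl_E + b = j + m_E` at the boundary value `m_E = 2b` of the strip `m_E < 2b` of ★ G7 ∕ ★ G8, and those workers spend the strip letter only through ★ G4 ∕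
★ G4′'s `1 ≤ |γ₁|` and lower digit bound, which hold up to `m_E ≤ 2b + ℓ₀ − 1` — so on the WIDE strip `m < 4b + 2(d % 2)` the same assemblies run (W4 `…UpperRayCellLettersWide`,
W7 `…OffRowCUpperRayWorkerWide`, W8 `…OffRowCUpperRayDiagWide`), and the corner tail converts to the wide tail by arithmetic: `m < 4b + 2` (d odd), `jl + 2b = 2j + d_ρ + m`,
LOW `2b + m_c ≤ m` ⟸ the floor `2m_c ≤ N d tE ≤ m = 4b`, RAY `2m⋆ + 2b ≤ m` ⟸ `m⋆ ≤ b`.  The parity letter splits into W8 (diagonal `j + 1 = b + s0`) and W7 (generic).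
* HEAD `offRowCC_ray_holds (N) (hN)`.  Kernel line: `offRowCC_of_exactLevel_bands N hN (offRowCC_ray_holds N hN) ‹hM : HC_MIX_C♮›` (★ C6) is lane C's `hCorner` for ★ p863855
  `offRowC_holds_of_lines₂ N hN ‹hTopLo› ‹hLow› ‹hCorner›`; after this file the corner waits on ‹HC_MIX_C♮› ALONE.
HONEST LABEL.  Count-neutral composition of this seat's W7∕W8 over the ★ lane-free RAY kit; nothing printed is asserted; no census law is stated; ‹HC_MIX_C♮›, ‹HU_MIX_C♮›, ‹HL_RAY_C♭›,
‹HL_MIX_C♭›, ‹ROW_C›, β₂ `stub_law_cleanSgn₂` stay UNPROVED; `HC_CM` is proved only modulo the 7 printed citations (2 remaining named inputs: hLiu418 = `stmt-HodgeConjecture-24832`,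
h413 = `stmt-HodgeConjecture-24833`) until rung 0 closes.
## References
* [Kottwitz1986BaseChangeUnits] R. E. Kottwitz, *Base change for unit elements of Hecke algebras*, Compositio Math. 60 (1986): §1 pp. 240–241, §3.
* [Rogawski1990] J. D. Rogawski, *Automorphic Representations of Unitary Groups in Three Variables*, Ann. of Math. Stud. 123 (1990): §4.9 Prop. 4.9.1 (b) p. 55, §12.2.
* [Serre1979] J.-P. Serre, *Local Fields*, GTM 67 (1979): Ch. V §3 Cor. 3; Ch. XV §2.
-/

set_option autoImplicit false

noncomputable section

namespace Summit.HodgeConjecture.HodgeConjecture.Cruxes.H413.F0P3cDyRamBeta2ConesOffRowCCornerRayHolds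

open scoped Valued WithZero Matrix MatrixGroups Pointwise Classical
open WithZero
open Literature.NumberTheory.Automorphic Literature.NumberTheory.Automorphic.HermitianLattice Literature.NumberTheory.Automorphic.UnitaryLatticeTree
open Literature.NumberTheory.Automorphic.UnitaryGroup
open Literature.NumberTheory.Automorphic.UnitaryThreeFourFrame (IsRamifiedQuadraticDatum)
open Literature.NumberTheory.Rogawski1990
open Summit.HodgeConjecture.HodgeConjecture.Cruxes.H413.F0P3cDyRamFourFramePieces
open Summit.HodgeConjecture.HodgeConjecture.Cruxes.H413.F0P3cDyRamFourFrameCensusDefs (LatticeInLevel LatticeNearTransvShell)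
open Summit.HodgeConjecture.HodgeConjecture.Cruxes.H413.F0P3cDyRamStageOneBDefs (mcOfRecord)
open Summit.HodgeConjecture.HodgeConjecture.Cruxes.H413.F0P3cDyRamToricCensusDefs
open Summit.HodgeConjecture.HodgeConjecture.Cruxes.H413.F0P3cDyRamBeta2ConesOffRowCUpperRayWorkerWide (cellDiff_topLine_rayGen_eq_zero_ramM_wide)
open Summit.HodgeConjecture.HodgeConjecture.Cruxes.H413.F0P3cDyRamBeta2ConesOffRowCUpperRayDiagWide (cellDiff_topLine_rayDiag_eq_zero_ramM_wide)

/-- **HEAD — «THE CORNER RAY BAND OF LANE C IS PAID»**: ‹HC_RAY_C♮› (= the binder `hR` of ★ C6 `offRowCC_of_exactLevel_bands`, BYTE FOR BYTE) — on the lane-C corner cell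
(`d` odd, `m = 4b`, `jl = 2j + d_ρ + 2b`, `m⋆ ≤ b`) the labelled (β₂) difference of the (OFF_C) residue's two exact-level RAY literals vanishes; by the parity letter's case split into
W8 (diagonal branch) and W7 (generic branch) on the wide strip, the corner tail ↦ the wide top-line tail by arithmetic (floor `2m_c ≤ N ≤ m`).
[cite: Kottwitz1986BaseChangeUnits, §1 pp. 240–241; §3] [cite: Rogawski1990, §4.9 Prop. 4.9.1 (b) p. 55] [cite: Serre1979, Ch. V §3 Cor. 3; Ch. XV §2] -/
theorem offRowCC_ray_holds (N : ℕ → ℕ → ℕ) (hN : ∀ d t, 2 * mcOfRecord d ≤ N d t) :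
      ∀ (E M : Type) [Field E] [Valued E ℤᵐ⁰] [CompleteSpace E] [IsDiscreteValuationRing 𝒪[E]] [Finite 𝓀[E]]
        [Field M] [Valued M ℤᵐ⁰] [CompleteSpace M] [IsDiscreteValuationRing 𝒪[M]] [Finite 𝓀[M]]
        (σ : E →+* E) (ϖ : E) (d tE : ℕ) (_hD : IsRamifiedQuadraticDatum σ ϖ d tE) (_hσσ : ∀ a, σ (σ a) = a) (_h2 : ¬ IsUnit (2 : 𝒪[E]))
        (jE : E →+* M) (ρ Θ : M →+* M) (α lam : M)
        (_hρρ : ∀ z, ρ (ρ z) = z) (_hvρ : ∀ z, Valued.v (ρ z) = Valued.v z) (_hρj : ∀ a, ρ (jE a) = jE a)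
        (_hjv : ∀ a, Valued.v (jE a) ≤ 1 ↔ Valued.v a ≤ 1) (_hjfix : ∀ z : M, ρ z = z ↔ ∃ a, jE a = z) (_hΘj : ∀ a, Θ (jE a) = jE (σ a))
        (_hΘΘ : ∀ z, Θ (Θ z) = z) (_hΘρ : ∀ z, Θ (ρ z) = ρ (Θ z)) (_hvΘ : ∀ z, Valued.v (Θ z) = Valued.v z)
        (_hα : ρ α ≠ α) (_hα1 : Valued.v α ≤ 1) (_hint : ∀ z : M, Valued.v z ≤ 1 → Valued.v ((z - ρ z) / (α - ρ α)) ≤ 1)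
        (_hΘlam : Θ lam * lam = 1) (_hvlam : Valued.v lam = 1) (_hbasis : ∀ z : M, ∃! pq : E × E, z = jE pq.1 + jE pq.2 * lam)
        (_hC : Valued.v (α - ρ α) < 1) (ϖM c₀ n₀ : M) (dρ dΘ dτ g s0 dK d' : ℕ)
        (_c1 : ∀ a, Valued.v (jE a) = Valued.v a ^ 2) (_c2 : Nat.card 𝓀[M] = Nat.card 𝓀[E]) (_c3 : ∀ z : M, Valued.v z ≤ 1 → Valued.v (z - Θ z) < 1) (_c4 : ∀ z : M, Valued.v z ≤ 1 → Valued.v (z - Θ (ρ z)) < 1)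
        (_c5 : Valued.v ϖM = WithZero.exp (-1 : ℤ)) (_c6 : α - ρ α = ϖM - ρ ϖM) (_c7 : IsRamifiedQuadraticDatum ρ ϖM dρ (2 * tE)) (_c8 : IsRamifiedQuadraticDatum Θ ϖM dΘ (2 * tE)) (_c9 : 1 ≤ dτ)
        (_c10 : Valued.v (ϖM - Θ (ρ ϖM)) = Valued.v ϖM ^ dτ) (_c11 : Θ c₀ = c₀) (_c12 : Valued.v c₀ = 1) (_c13 : ∀ x : M, Θ x = x → Valued.v x = 1 → (∃ z : M, z * Θ z = x) ∨ ∃ z : M, z * Θ z = c₀ * x)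
        (_c14 : ∀ f₀ : M, ρ f₀ = f₀ → Θ f₀ = f₀ → Valued.v f₀ = 1 → ∃ z : M, z * Θ z = f₀) (_c15 : Θ n₀ = n₀) (_c16 : Valued.v n₀ = 1) (_c17 : ¬ ∃ z : M, z * Θ z = n₀)
        (_c18 : ∀ x : M, ρ x = x → Θ (ρ x) = x → x ≠ 0 → ∃ n : ℤ, Valued.v x = WithZero.exp (4 * n)) (_c19 : ∀ z : M, ρ z = z → Θ z = z → z ≠ 0 → ∃ n : ℤ, Valued.v z = WithZero.exp (4 * n))
        (_c20 : ∃ a : M, Θ a = a ∧ Valued.v a = 1 ∧ ¬ ∃ e : M, ρ e = e ∧ e * Θ e = a * ρ a) (_c21 : dΘ = 2 * g) (_c22 : dτ = 2 * s0) (_c23 : 1 ≤ g) (_c24 : 1 ≤ s0) (_c25 : g + s0 = d)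
        (_c26 : Valued.v (ϖM * Θ (ρ ϖM) - ρ (ϖM * Θ (ρ ϖM))) = WithZero.exp (-(2 * (dK : ℤ)))) (_c27 : 2 * dK = dρ + 2 * g)
        (_c28 : Valued.v (ϖM * Θ ϖM - ρ (ϖM * Θ ϖM)) = WithZero.exp (-(2 * (d' : ℤ)))) (_c29 : 2 * d' = dρ + dτ) (_hjpow : ∀ (t : E) (n : ℤ), Valued.v (jE t) = Valued.v (jE ϖ) ^ n ↔ Valued.v t = Valued.v ϖ ^ n)
        (_hEval : ∀ c : M, ρ c = c → c ≠ 0 → Valued.v c ≤ 1 → ∃ n : ℕ, Valued.v c = Valued.v (jE ϖ) ^ n)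
        (_hϖmax : ∀ t : M, ρ t = t → Valued.v t < 1 → Valued.v t ≤ Valued.v (jE ϖ))
        (γ₂ : GL (Fin 2) E) (u : GL (Fin 1) E)
        (_hdet : (γ₂ : Matrix (Fin 2) (Fin 2) E).det * σ (γ₂ : Matrix (Fin 2) (Fin 2) E).det = 1)
        (_htr : (γ₂ : Matrix (Fin 2) (Fin 2) E).trace = (γ₂ : Matrix (Fin 2) (Fin 2) E).det * σ (γ₂ : Matrix (Fin 2) (Fin 2) E).trace)
        (_hirr : ∀ x : E, x * x - (γ₂ : Matrix (Fin 2) (Fin 2) E).trace * x + (γ₂ : Matrix (Fin 2) (Fin 2) E).det ≠ 0)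
        (_hlam2 : lam * lam = jE (γ₂ : Matrix (Fin 2) (Fin 2) E).trace * lam - jE (γ₂ : Matrix (Fin 2) (Fin 2) E).det)
        (_hρlam : ρ lam = jE (γ₂ : Matrix (Fin 2) (Fin 2) E).trace - lam) (m jl : ℕ) (_hm : Valued.v (lam - jE ((u : Matrix (Fin 1) (Fin 1) E) 0 0)) = WithZero.exp (-(m : ℤ)))
        (_hjl : Valued.v ((lam - jE ((u : Matrix (Fin 1) (Fin 1) E) 0 0)) - ρ (lam - jE ((u : Matrix (Fin 1) (Fin 1) E) 0 0))) = WithZero.exp (-(jl : ℤ)))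
        (_hs : Valued.v ((γ₂ : Matrix (Fin 2) (Fin 2) E).trace - 2) * Valued.v (ϖ ^ (d % 2)) ≤ Valued.v (ϖ ^ mcOfRecord d))
        (_hp : Valued.v ((γ₂ : Matrix (Fin 2) (Fin 2) E).det - (γ₂ : Matrix (Fin 2) (Fin 2) E).trace + 1) ≤ Valued.v (ϖ ^ mcOfRecord d))
        (_hNm : N d tE ≤ m) (_hu1N : Valued.v (((u : Matrix (Fin 1) (Fin 1) E) 0 0) - 1) ≤ Valued.v (ϖ ^ N d tE)) (_hlam1 : Valued.v (lam - 1) ≤ Valued.v (jE ϖ ^ N d tE))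
        (_hu : Valued.v ((u : Matrix (Fin 1) (Fin 1) E) 0 0) = 1) (_hum : Valued.v (((u : Matrix (Fin 1) (Fin 1) E) 0 0) - 1) ≤ Valued.v (ϖ ^ mstarOfRecord d))
        (H₂ : Matrix (Fin 2) (Fin 2) E) (hW : E) (_hH₂ : IsUnit H₂.det) (_hH₂σ : (H₂.map σ)ᵀ = H₂) (_hhW : Valued.v hW = 1) (_hhWσ : σ hW = hW)
        (P₁ : GL (Fin 3) E) (_hA : formCongr σ P₁ ((StdForm.antidiagonal 3).over E) = (!![H₂ 0 0, 0, H₂ 0 1; 0, hW, 0; H₂ 1 0, 0, H₂ 1 1] : Matrix (Fin 3) (Fin 3) E))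
        (_hΓ : P₁ * endoGL (γ₂, u) * P₁⁻¹ ∈ unitaryGroupOfForm σ ((StdForm.antidiagonal 3).over E))
        (φ : (Fin 2 → E) →+ M) (h : M) (_hφs : ∀ (c : E) (x : Fin 2 → E), φ (c • x) = jE c * φ x) (_hφi : Function.Injective φ) (_hφo : Function.Surjective φ)
        (_hφγ : ∀ x, φ ((γ₂ : Matrix (Fin 2) (Fin 2) E).mulVec x) = lam * φ x)
        (_hform : ∀ x y, jE (pairing σ H₂ x y) = h * Θ (φ x) * φ y + ρ (h * Θ (φ x) * φ y)) (_hΘh : Θ h = h) (_hh : h ≠ 0)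
        (J R : ℕ) (f : ℕ → ℕ → AddSubgroup M → ℕ)
        (_hfinF : {L₃ : Submodule 𝒪[E] (Fin 3 → E) | IsSelfDualLattice σ ϖ (!![H₂ 0 0, 0, H₂ 0 1; 0, hW, 0; H₂ 1 0, 0, H₂ 1 1] : Matrix (Fin 3) (Fin 3) E) L₃ ∧ mapGL (endoGL (γ₂, u)) L₃ = L₃}.Finite)
        (_hR : ∀ L₃ : Submodule 𝒪[E] (Fin 3 → E), IsSelfDualLattice σ ϖ (!![H₂ 0 0, 0, H₂ 0 1; 0, hW, 0; H₂ 1 0, 0, H₂ 1 1] : Matrix (Fin 3) (Fin 3) E) L₃ →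
          mapGL (endoGL (γ₂, u)) L₃ = L₃ → ∀ b : ℕ, (∀ c : E, (Pi.single 1 c : Fin 3 → E) ∈ L₃ ↔ Valued.v c ≤ Valued.v ϖ ^ b) → b ≤ R)
        (_hJ : ¬ IsOrd ρ α (jE ϖ ^ (J + 1)) lam) (_hfinLS : ∀ j a, (levelSet ρ Θ α (jE ϖ) h j a).Finite)
        (_hf : ∀ (b j : ℕ) (Λ : AddSubgroup M) (x₀ : M) (r : E), 1 ≤ b → x₀ ≠ 0 → (∀ x, x ∈ Λ ↔ ∃ z, IsOrd ρ α (jE ϖ ^ j) z ∧ x = x₀ * z) →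
          IsOrd ρ α (jE ϖ ^ j) (dualGen ρ Θ α (jE ϖ ^ j) h x₀) → ¬ IsOrd ρ α (jE ϖ ^ j) (dualGen ρ Θ α (jE ϖ ^ j) h x₀ / jE ϖ) → Valued.v (dualGen ρ Θ α (jE ϖ ^ j) h x₀) = Valued.v (jE ϖ) ^ b →
          (∀ b', (∀ x ∈ Λ, Valued.v (h * Θ x * b' + ρ (h * Θ x * b')) ≤ 1) → (lam - jE ((u : Matrix (Fin 1) (Fin 1) E) 0 0)) * b' ∈ Λ) → IsOrd ρ α (jE ϖ ^ j) lam →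
          jE r = glueUnit ρ Θ α (jE ϖ ^ j) h (jE ϖ) (jE hW) x₀ b →
          f b j Λ = Nat.card {x : 𝒪[E] ⧸ 𝓂[E] ^ (2 * b) // ∃ u' : 𝒪[E], Ideal.Quotient.mk (𝓂[E] ^ (2 * b)) u' = x ∧ Valued.v ((u' : E) * σ u' - r) ≤ Valued.v (ϖ ^ (2 * b))}),
        ∀ j b : ℕ, 1 ≤ b → b ≤ j → d % 2 = 1 → m = 4 * b → jl = 2 * j + dρ + 2 * b → (j + 1 = b + s0 ∨ (b + s0 ≤ j ∧ (j - b - s0) % 2 = 0)) → mstarOfRecord d ≤ b → IsOrd ρ α (jE ϖ ^ j) lam →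
                ((∑ᶠ Λ ∈ levelSetDep ρ Θ α (jE ϖ) h j b (lam - jE ((u : Matrix (Fin 1) (Fin 1) E) 0 0)) ∩
                      {Λ | ∃ B : Submodule 𝒪[E] (Fin 2 → E), B.toAddSubgroup.map φ = Λ ∧
                        ∃ L₃ : Submodule 𝒪[E] (Fin 3 → E), IsSelfDualLattice σ ϖ (!![H₂ 0 0, 0, H₂ 0 1; 0, hW, 0; H₂ 1 0, 0, H₂ 1 1] : Matrix (Fin 3) (Fin 3) E) L₃ ∧
                          L₃ ⊓ LinearMap.ker ((LinearMap.proj (1 : Fin 3) : (Fin 3 → E) →ₗ[E] E).restrictScalars 𝒪[E]) =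
                            B.map ((Matrix.toLin' (!![1, 0; 0, 0; 0, 1] : Matrix (Fin 3) (Fin 2) E)).restrictScalars 𝒪[E]) ∧
                          (∀ c : E, (Pi.single 1 c : Fin 3 → E) ∈ L₃ ↔ Valued.v c ≤ Valued.v ϖ ^ b) ∧
                          ((LatticeInLevel ϖ (d % 2) ((((endoGL (γ₂, u) : GL (Fin 3) E) : Matrix (Fin 3) (Fin 3) E) - 1)) L₃ ∧
                            ¬ LatticeInLevel ϖ (d % 2 + 1) ((((endoGL (γ₂, u) : GL (Fin 3) E) : Matrix (Fin 3) (Fin 3) E) - 1)) L₃) ∧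
                            {z : E | ∃ y ∈ L₃, Valued.v ((ϖ ^ (mstarOfRecord d))⁻¹ * (z - pairing σ (!![H₂ 0 0, 0, H₂ 0 1; 0, hW, 0; H₂ 1 0, 0, H₂ 1 1] : Matrix (Fin 3) (Fin 3) E) y (((((endoGL (γ₂, u) : GL (Fin 3) E) : Matrix (Fin 3) (Fin 3) E) - 1)) *ᵥ y))) ≤ 1} =
                              valueSetMod σ ϖ (mstarOfRecord d) (xPlus σ ϖ d))}, f b j Λ : ℕ) : ℤ) -
                  ((∑ᶠ Λ ∈ levelSetDep ρ Θ α (jE ϖ) h j b (lam - jE ((u : Matrix (Fin 1) (Fin 1) E) 0 0)) ∩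
                      {Λ | ∃ B : Submodule 𝒪[E] (Fin 2 → E), B.toAddSubgroup.map φ = Λ ∧
                        ∃ L₃ : Submodule 𝒪[E] (Fin 3 → E), IsSelfDualLattice σ ϖ (!![H₂ 0 0, 0, H₂ 0 1; 0, hW, 0; H₂ 1 0, 0, H₂ 1 1] : Matrix (Fin 3) (Fin 3) E) L₃ ∧
                          L₃ ⊓ LinearMap.ker ((LinearMap.proj (1 : Fin 3) : (Fin 3 → E) →ₗ[E] E).restrictScalars 𝒪[E]) =
                            B.map ((Matrix.toLin' (!![1, 0; 0, 0; 0, 1] : Matrix (Fin 3) (Fin 2) E)).restrictScalars 𝒪[E]) ∧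
                          (∀ c : E, (Pi.single 1 c : Fin 3 → E) ∈ L₃ ↔ Valued.v c ≤ Valued.v ϖ ^ b) ∧
                          ((LatticeInLevel ϖ (d % 2) ((((endoGL (γ₂, u) : GL (Fin 3) E) : Matrix (Fin 3) (Fin 3) E) - 1)) L₃ ∧
                            ¬ LatticeInLevel ϖ (d % 2 + 1) ((((endoGL (γ₂, u) : GL (Fin 3) E) : Matrix (Fin 3) (Fin 3) E) - 1)) L₃) ∧
                            ¬ {z : E | ∃ y ∈ L₃, Valued.v ((ϖ ^ (mstarOfRecord d))⁻¹ * (z - pairing σ (!![H₂ 0 0, 0, H₂ 0 1; 0, hW, 0; H₂ 1 0, 0, H₂ 1 1] : Matrix (Fin 3) (Fin 3) E) y (((((endoGL (γ₂, u) : GL (Fin 3) E) : Matrix (Fin 3) (Fin 3) E) - 1)) *ᵥ y))) ≤ 1} =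
                              valueSetMod σ ϖ (mstarOfRecord d) (xPlus σ ϖ d))}, f b j Λ : ℕ) : ℤ) = 0 := by
  intro E M _ _ _ _ _ _ _ _ _ _ σ ϖ d tE _hD _hσσ _h2 jE ρ Θ α lam _hρρ _hvρ _hρj _hjv _hjfix _hΘj _hΘΘ _hΘρ _hvΘ _hα _hα1 _hint _hΘlam _hvlam _hbasis _hC ϖM c₀ n₀ dρ dΘ dτ g s0 dK d'
    _c1 _c2 _c3 _c4 _c5 _c6 _c7 _c8 _c9 _c10 _c11 _c12 _c13 _c14 _c15 _c16 _c17 _c18 _c19 _c20 _c21 _c22 _c23 _c24 _c25 _c26 _c27 _c28 _c29 _hjpow _hEval _hϖmax γ₂ u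
    _hdet _htr _hirr _hlam2 _hρlam m jl _hm _hjl _hs _hp _hNm _hu1N _hlam1 _hu _hum H₂ hW _hH₂ _hH₂σ _hhW _hhWσ P₁ _hA _hΓ φ h _hφs _hφi _hφo _hφγ _hform _hΘh _hh J R f _hfinF _hR _hJ
    _hfinLS _hf j b hb1 hbj hd1 h4b hline hpar hray hlamj
  -- the corner tail ↦ the wide top-line tail (floor `2·m_c ≤ N d tE ≤ m = 4b`, `d % 2 = 1`, RAY `m⋆ ≤ b`)
  have hNfl : 2 * mcOfRecord d ≤ N d tE := hN d tE
  have hwide : m < 4 * b + 2 * (d % 2) := by omega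
  have hline' : jl + 2 * b = 2 * j + dρ + m := by omega
  have hlow : 2 * b + mcOfRecord d ≤ m := by omega
  have hray' : 2 * mstarOfRecord d + 2 * b ≤ m := by omega
  rcases hpar with hpd | hpg
  · exact cellDiff_topLine_rayDiag_eq_zero_ramM_wide N hN E M σ ϖ d tE _hD _hσσ _h2 jE ρ Θ α lam _hρρ _hvρ _hρj _hjv _hjfix _hΘj _hΘΘ _hΘρ _hvΘ _hα _hα1 _hint _hΘlam
      _hvlam _hbasis _hC ϖM c₀ n₀ dρ dΘ dτ g s0 dK d' _c1 _c2 _c3 _c4 _c5 _c6 _c7 _c8 _c9 _c10 _c11 _c12 _c13 _c14 _c15 _c16 _c17 _c18 _c19 _c20 _c21 _c22 _c23 _c24 _c25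
      _c26 _c27 _c28 _c29 _hjpow _hEval _hϖmax γ₂ u _hdet _htr _hirr _hlam2 _hρlam m jl _hm _hjl _hs _hp _hNm _hu1N _hlam1 _hu _hum H₂ hW _hH₂ _hH₂σ _hhW _hhWσ P₁ _hA _hΓ φ
      h _hφs _hφi _hφo _hφγ _hform _hΘh _hh J R f _hfinF _hR _hJ _hfinLS _hf j b hb1 hbj hwide hline' hlow hpd hray' hlamj
  · exact cellDiff_topLine_rayGen_eq_zero_ramM_wide N hN E M σ ϖ d tE _hD _hσσ _h2 jE ρ Θ α lam _hρρ _hvρ _hρj _hjv _hjfix _hΘj _hΘΘ _hΘρ _hvΘ _hα _hα1 _hint _hΘlam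
      _hvlam _hbasis _hC ϖM c₀ n₀ dρ dΘ dτ g s0 dK d' _c1 _c2 _c3 _c4 _c5 _c6 _c7 _c8 _c9 _c10 _c11 _c12 _c13 _c14 _c15 _c16 _c17 _c18 _c19 _c20 _c21 _c22 _c23 _c24 _c25
      _c26 _c27 _c28 _c29 _hjpow _hEval _hϖmax γ₂ u _hdet _htr _hirr _hlam2 _hρlam m jl _hm _hjl _hs _hp _hNm _hu1N _hlam1 _hu _hum H₂ hW _hH₂ _hH₂σ _hhW _hhWσ P₁ _hA _hΓ φ
      h _hφs _hφi _hφo _hφγ _hform _hΘh _hh J R f _hfinF _hR _hJ _hfinLS _hf j b hb1 hbj hwide hline' hlow hpg hray' hlamj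

end Summit.HodgeConjecture.HodgeConjecture.Cruxes.H413.F0P3cDyRamBeta2ConesOffRowCCornerRayHolds

end
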